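import Summits.QuantumFields.YangMills.Theses.BalabanFluctuationExport
import HarnessLib

/-!
# Route item `CondDecouplingGlue` of `BalabanFluctuationExport` (line `field_regime_split` on the crux `UVSeamRec`, stmt-QuantumFields-20043)

Support item stmt-QuantumFields-26275 of the draft export route `BalabanFluctuationExport`:
`SmallFieldDecoupling → RoughFieldDecoupling → SmallEventMeasurable → CondDecoupling`.  Take the rough half's `δ`, instantiate
the small half there; split a test function `Ψ` of the block field along the (measurable) δ-small event, `Ψ = Ψ·χ_small + Ψ·χ_rough`,
both pieces measurable with `|·| ≤ 1`; the two bounds add and `∫|Ψχ_s∘Q| + ∫|Ψχ_r∘Q| = ∫|Ψ∘Q|`; constants `(max C₁ C₂, max β₁ β₂,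
min ℓ₁ ℓ₂)`.  `condDecoupling_of_split_expanded` runs the tactic proof against the `let`-expanded form of `CondDecoupling`
(definitionally the route decl), `condDecouplingGlue_proof` is the route item by name.

The proof is the ideator's kernel-checked glue (ym-idea-9, `Cruxes/UVSeamRec/Lines/field_regime_split.lean`,
`condDecoupling_of_splitX`), landed under `Theorems/` so that the route item is closed by name.  Bookkeeping only: neither half of the
decoupling, nor E0′, NT or the gap is proved; YM mass gap NOT proved.
-/

set_option autoImplicit false

namespace Summit.QuantumFields.YangMills.Cruxes.UVSeamRec.ExportGlue

open MeasureTheory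
open Literature.MathematicalPhysics.QuantumFieldTheory
open Literature.MathematicalPhysics.QuantumFieldTheory.Balaban1983to89
open Literature.MathematicalPhysics.QuantumFieldTheory.Balaban1983to89.T4Continuum
open Literature.MathematicalPhysics.QuantumLattice (LGConfig torusLift fundamentalLatticeRep)
open Summit.QuantumFields.YangMills.Cruxes.OSLegsFromFemtoAndGap.DlrCollarTransfer (plane)
open Summit.QuantumFields.YangMills.Cruxes.UV.TorusClass (torusEOn)
open Summit.QuantumFields.YangMills.Theses.BalabanFluctuationExport

/-- The glue, proved against the `let`-expanded form of the parent `CondDecoupling` (definitionally equal to the route decl). -/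
theorem condDecoupling_of_split_expanded :
    SmallFieldDecoupling → RoughFieldDecoupling → SmallEventMeasurable →
      letI : MeasurableSpace (Matrix.specialUnitaryGroup (Fin 2) ℂ) := borel _
      haveI : BorelSpace (Matrix.specialUnitaryGroup (Fin 2) ℂ) := ⟨rfl⟩
      ∀ L : ℕ, Odd L → 11 < L →
      ∃ (C β₄ ℓ₄ : ℝ), 0 < ℓ₄ ∧ 0 ≤ C ∧ ∀ β : ℝ, β₄ ≤ β →
        ∀ (F : T4Family) (K k : ℕ), F.L = L → k + 1 ≤ F.m + K →
          ((L : ℝ) ^ k) * Summit.QuantumFields.YangMills.Cruxes.UVSeamRec.Transport.uRec β ≤ ℓ₄ →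
          haveI : NeZero ((F.P K).sitesPerDir 0) := ⟨Params.sitesPerDir_ne_zero _ _⟩
          ∀ (n : ℕ) (q : Fin n → Fin 4 × Fin 4) (x : Fin n → (Fin 4 → ℤ)), (∀ i, (q i).1 < (q i).2) →
            (∀ i j : Fin n, i ≠ j → ∃ κ : Fin 4,
              (2 * ((L : ℤ) ^ k) + 4) ≤ |((((x i κ - x j κ : ℤ) : ZMod ((F.P K).sitesPerDir 0))).valMinAbs : ℤ)|) →
            ∀ g : Fin n → (GaugeField (F.P K) k (Matrix.specialUnitaryGroup (Fin 2) ℂ) → ℝ),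
              (∃ D : ℝ, ∀ i W, |g i W| ≤ D) →
              (∀ i, Measurable (fun V : GaugeConfig 4 ((F.P K).sitesPerDir 0) (Matrix.specialUnitaryGroup (Fin 2) ℂ) =>
                  g i (Averaging.iter (fun j => BlockAveraging.blockAvg (P := F.P K) (j := j) su2Mean) k
                    (ofConfig (P := F.P K) (j := 0) V)))) →
              (∀ i, ∀ φ : GaugeField (F.P K) k (Matrix.specialUnitaryGroup (Fin 2) ℂ) → ℝ,
                Measurable (fun V : GaugeConfig 4 ((F.P K).sitesPerDir 0) (Matrix.specialUnitaryGroup (Fin 2) ℂ) =>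
                  φ (Averaging.iter (fun j => BlockAveraging.blockAvg (P := F.P K) (j := j) su2Mean) k
                    (ofConfig (P := F.P K) (j := 0) V))) →
                (∀ W, |φ W| ≤ 1) →
                ∫ V, (plane (Matrix.specialUnitaryGroup (Fin 2) ℂ) (fundamentalLatticeRep 2) (q i) (x i)
                        (torusLift ((F.P K).sitesPerDir 0) V)
                      - g i (Averaging.iter (fun j => BlockAveraging.blockAvg (P := F.P K) (j := j) su2Mean) k
                          (ofConfig (P := F.P K) (j := 0) V)))
                    * φ (Averaging.iter (fun j => BlockAveraging.blockAvg (P := F.P K) (j := j) su2Mean) k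
                          (ofConfig (P := F.P K) (j := 0) V))
                  ∂(wilsonMeasure (d := 4) (L := (F.P K).sitesPerDir 0) (fundamentalLatticeRep 2).ρ β) = 0) →
            ∀ Ψ : GaugeField (F.P K) k (Matrix.specialUnitaryGroup (Fin 2) ℂ) → ℝ,
              Measurable (fun V : GaugeConfig 4 ((F.P K).sitesPerDir 0) (Matrix.specialUnitaryGroup (Fin 2) ℂ) =>
                  Ψ (Averaging.iter (fun j => BlockAveraging.blockAvg (P := F.P K) (j := j) su2Mean) k
                    (ofConfig (P := F.P K) (j := 0) V))) →
              (∀ W, |Ψ W| ≤ 1) →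
              |∫ V, (∏ i, (plane (Matrix.specialUnitaryGroup (Fin 2) ℂ) (fundamentalLatticeRep 2) (q i) (x i)
                        (torusLift ((F.P K).sitesPerDir 0) V)
                      - g i (Averaging.iter (fun j => BlockAveraging.blockAvg (P := F.P K) (j := j) su2Mean) k
                          (ofConfig (P := F.P K) (j := 0) V))))
                    * Ψ (Averaging.iter (fun j => BlockAveraging.blockAvg (P := F.P K) (j := j) su2Mean) k
                          (ofConfig (P := F.P K) (j := 0) V))
                  ∂(wilsonMeasure (d := 4) (L := (F.P K).sitesPerDir 0) (fundamentalLatticeRep 2).ρ β)|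
                ≤ (C / ((L : ℝ) ^ k) ^ 4) ^ n *
                  ∫ V, |Ψ (Averaging.iter (fun j => BlockAveraging.blockAvg (P := F.P K) (j := j) su2Mean) k
                          (ofConfig (P := F.P K) (j := 0) V))|
                    ∂(wilsonMeasure (d := 4) (L := (F.P K).sitesPerDir 0) (fundamentalLatticeRep 2).ρ β) := by
  classical
  intro hS hR hM
  letI : MeasurableSpace (Matrix.specialUnitaryGroup (Fin 2) ℂ) := borel _
  haveI : BorelSpace (Matrix.specialUnitaryGroup (Fin 2) ℂ) := ⟨rfl⟩
  intro L hLo hL11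
  obtain ⟨δ, hδ0, hδ1, C₂, β₂, ℓ₂, hℓ₂, hC₂, hRough⟩ := hR L hLo hL11
  obtain ⟨C₁, β₁, ℓ₁, hℓ₁, hC₁, hSmall⟩ := hS L hLo hL11 δ hδ0 hδ1
  refine ⟨max C₁ C₂, max β₁ β₂, min ℓ₁ ℓ₂, lt_min hℓ₁ hℓ₂, le_max_of_le_left hC₁, ?_⟩
  intro β hβ F K k hFL hk hb n q x hq hsep g hgb hgm horth Ψ hΨm hΨb
  haveI : NeZero ((F.P K).sitesPerDir 0) := ⟨Params.sitesPerDir_ne_zero _ _⟩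
  -- abbreviations
  set M : ℕ := (F.P K).sitesPerDir 0 with hMdef
  set Q : GaugeConfig 4 M (Matrix.specialUnitaryGroup (Fin 2) ℂ) →
      GaugeField (F.P K) k (Matrix.specialUnitaryGroup (Fin 2) ℂ) :=
    fun V => Averaging.iter (fun j => BlockAveraging.blockAvg (P := F.P K) (j := j) su2Mean) k
      (ofConfig (P := F.P K) (j := 0) V) with hQdef
  set μ : Measure (GaugeConfig 4 M (Matrix.specialUnitaryGroup (Fin 2) ℂ)) :=
    wilsonMeasure (d := 4) (L := M) (fundamentalLatticeRep 2).ρ β with hμdef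
  set T : GaugeConfig 4 M (Matrix.specialUnitaryGroup (Fin 2) ℂ) → ℝ :=
    fun V => ∏ i, (plane (Matrix.specialUnitaryGroup (Fin 2) ℂ) (fundamentalLatticeRep 2) (q i) (x i) (torusLift M V)
      - g i (Q V)) with hTdef
  let cs : Fin n → Site (F.P K) k :=
    fun i ν => (((((x i ν : ℤ) : ZMod ((F.P K).sitesPerDir 0))).val / F.L ^ k : ℕ) : ZMod ((F.P K).sitesPerDir k))
  let Sm : GaugeField (F.P K) k (Matrix.specialUnitaryGroup (Fin 2) ℂ) → Prop :=
    fun W => PlaqSmallOn {pl : Plaq (F.P K) k | ∃ i, Site.tdist pl.src (cs i) ≤ 2} δ W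
  let Ψs : GaugeField (F.P K) k (Matrix.specialUnitaryGroup (Fin 2) ℂ) → ℝ := fun W => if Sm W then Ψ W else 0
  let Ψr : GaugeField (F.P K) k (Matrix.specialUnitaryGroup (Fin 2) ℂ) → ℝ := fun W => if Sm W then 0 else Ψ W
  -- measurability of the small-field event and of the two pieces
  have hSm : MeasurableSet {V : GaugeConfig 4 M (Matrix.specialUnitaryGroup (Fin 2) ℂ) | Sm (Q V)} := hM δ F K k hk n x
  have hΨsm : Measurable (fun V => Ψs (Q V)) := Measurable.ite hSm hΨm measurable_const
  have hΨrm : Measurable (fun V => Ψr (Q V)) := Measurable.ite hSm measurable_const hΨm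
  have hΨsb : ∀ W, |Ψs W| ≤ 1 := fun W => by
    by_cases h : Sm W <;> simp [Ψs, h, hΨb W]
  have hΨrb : ∀ W, |Ψr W| ≤ 1 := fun W => by
    by_cases h : Sm W <;> simp [Ψr, h, hΨb W]
  have hΨss : ∀ W, ¬ Sm W → Ψs W = 0 := fun W h => by simp [Ψs, h]
  have hΨrs : ∀ W, Sm W → Ψr W = 0 := fun W h => by simp [Ψr, h]
  -- the two halves
  have hb₁ : ((L : ℝ) ^ k) * Summit.QuantumFields.YangMills.Cruxes.UVSeamRec.Transport.uRec β ≤ ℓ₁ := hb.trans (min_le_left _ _)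
  have hb₂ : ((L : ℝ) ^ k) * Summit.QuantumFields.YangMills.Cruxes.UVSeamRec.Transport.uRec β ≤ ℓ₂ := hb.trans (min_le_right _ _)
  have h1 : |∫ V, T V * Ψs (Q V) ∂μ| ≤ (C₁ / ((L : ℝ) ^ k) ^ 4) ^ n * ∫ V, |Ψs (Q V)| ∂μ :=
    hSmall β ((le_max_left _ _).trans hβ) F K k hFL hk hb₁ n q x hq hsep g hgb hgm horth Ψs hΨsm hΨsb hΨss
  have h2 : |∫ V, T V * Ψr (Q V) ∂μ| ≤ (C₂ / ((L : ℝ) ^ k) ^ 4) ^ n * ∫ V, |Ψr (Q V)| ∂μ :=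
    hRough β ((le_max_right _ _).trans hβ) F K k hFL hk hb₂ n q x hq hsep g hgb hgm horth Ψr hΨrm hΨrb hΨrs
  -- integrability bookkeeping
  haveI : IsProbabilityMeasure μ :=
    isProbabilityMeasure_wilsonMeasure (d := 4) (L := M) (fundamentalLatticeRep 2).ρ (fundamentalLatticeRep 2).continuous β
  obtain ⟨D, hD⟩ := hgb
  obtain ⟨B, hB⟩ := Summit.QuantumFields.YangMills.Cruxes.OSLegsFromFemtoAndGap.DlrCollarTransfer.exists_abs_plane_le
    (G := Matrix.specialUnitaryGroup (Fin 2) ℂ) (fundamentalLatticeRep 2)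
  have hTm : Measurable T := by
    refine Finset.measurable_prod _ fun i _ => ?_
    exact ((Summit.QuantumFields.YangMills.Cruxes.OSLegsFromFemtoAndGap.DlrCollarTransfer.continuous_plane
      (G := Matrix.specialUnitaryGroup (Fin 2) ℂ) (fundamentalLatticeRep 2) (q i) (x i)).measurable.comp
      (measurable_torusLift (d := 4) (G := Matrix.specialUnitaryGroup (Fin 2) ℂ) M)).sub (hgm i)
  have hTb : ∀ V, |T V| ≤ (B + D) ^ n := fun V => by
    simp only [hTdef, Finset.abs_prod]
    calc ∏ i, |plane (Matrix.specialUnitaryGroup (Fin 2) ℂ) (fundamentalLatticeRep 2) (q i) (x i) (torusLift M V) - g i (Q V)|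
        ≤ ∏ _i : Fin n, (B + D) := Finset.prod_le_prod (fun i _ => abs_nonneg _) fun i _ =>
            (abs_sub _ _).trans (add_le_add (hB _ _ _) (hD _ _))
      _ = (B + D) ^ n := by simp
  have hint : ∀ χ : GaugeField (F.P K) k (Matrix.specialUnitaryGroup (Fin 2) ℂ) → ℝ,
      Measurable (fun V => χ (Q V)) → (∀ W, |χ W| ≤ 1) → Integrable (fun V => T V * χ (Q V)) μ := fun χ hχm hχb => by
    refine Integrable.mono' (integrable_const ((B + D) ^ n * 1)) (hTm.mul hχm).aestronglyMeasurable
      (Filter.Eventually.of_forall fun V => ?_)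
    rw [Real.norm_eq_abs, abs_mul]
    exact mul_le_mul (hTb V) (hχb _) (abs_nonneg _) ((abs_nonneg _).trans (hTb V))
  have hintabs : ∀ χ : GaugeField (F.P K) k (Matrix.specialUnitaryGroup (Fin 2) ℂ) → ℝ,
      Measurable (fun V => χ (Q V)) → (∀ W, |χ W| ≤ 1) → Integrable (fun V => |χ (Q V)|) μ := fun χ hχm hχb => by
    refine Integrable.mono' (integrable_const (1 : ℝ)) hχm.abs.aestronglyMeasurable (Filter.Eventually.of_forall fun V => ?_)
    rw [Real.norm_eq_abs, abs_abs]; exact hχb _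
  -- pointwise splitting
  have hsplit : ∀ V, T V * Ψ (Q V) = T V * Ψs (Q V) + T V * Ψr (Q V) := fun V => by
    by_cases h : Sm (Q V) <;> simp [Ψs, Ψr, h]
  have habs : ∀ V, |Ψ (Q V)| = |Ψs (Q V)| + |Ψr (Q V)| := fun V => by
    by_cases h : Sm (Q V) <;> simp [Ψs, Ψr, h]
  have hI : ∫ V, T V * Ψ (Q V) ∂μ = ∫ V, T V * Ψs (Q V) ∂μ + ∫ V, T V * Ψr (Q V) ∂μ := by
    rw [← integral_add (hint Ψs hΨsm hΨsb) (hint Ψr hΨrm hΨrb)]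
    exact integral_congr_ae (Filter.Eventually.of_forall hsplit)
  have hIabs : ∫ V, |Ψ (Q V)| ∂μ = ∫ V, |Ψs (Q V)| ∂μ + ∫ V, |Ψr (Q V)| ∂μ := by
    rw [← integral_add (hintabs Ψs hΨsm hΨsb) (hintabs Ψr hΨrm hΨrb)]
    exact integral_congr_ae (Filter.Eventually.of_forall habs)
  -- constants
  have hLpos : (0 : ℝ) < ((L : ℝ) ^ k) ^ 4 := by positivity
  have hq₁ : (C₁ / ((L : ℝ) ^ k) ^ 4) ^ n ≤ (max C₁ C₂ / ((L : ℝ) ^ k) ^ 4) ^ n :=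
    pow_le_pow_left₀ (div_nonneg hC₁ hLpos.le) (div_le_div_of_nonneg_right (le_max_left _ _) hLpos.le) n
  have hq₂ : (C₂ / ((L : ℝ) ^ k) ^ 4) ^ n ≤ (max C₁ C₂ / ((L : ℝ) ^ k) ^ 4) ^ n :=
    pow_le_pow_left₀ (div_nonneg hC₂ hLpos.le) (div_le_div_of_nonneg_right (le_max_right _ _) hLpos.le) n
  have hIs : 0 ≤ ∫ V, |Ψs (Q V)| ∂μ := integral_nonneg fun V => abs_nonneg _
  have hIr : 0 ≤ ∫ V, |Ψr (Q V)| ∂μ := integral_nonneg fun V => abs_nonneg _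
  -- conclusion
  show |∫ V, T V * Ψ (Q V) ∂μ| ≤ (max C₁ C₂ / ((L : ℝ) ^ k) ^ 4) ^ n * ∫ V, |Ψ (Q V)| ∂μ
  rw [hI, hIabs, mul_add]
  calc |∫ V, T V * Ψs (Q V) ∂μ + ∫ V, T V * Ψr (Q V) ∂μ|
      ≤ |∫ V, T V * Ψs (Q V) ∂μ| + |∫ V, T V * Ψr (Q V) ∂μ| := abs_add_le _ _
    _ ≤ (C₁ / ((L : ℝ) ^ k) ^ 4) ^ n * ∫ V, |Ψs (Q V)| ∂μ + (C₂ / ((L : ℝ) ^ k) ^ 4) ^ n * ∫ V, |Ψr (Q V)| ∂μ :=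
        add_le_add h1 h2
    _ ≤ (max C₁ C₂ / ((L : ℝ) ^ k) ^ 4) ^ n * ∫ V, |Ψs (Q V)| ∂μ
        + (max C₁ C₂ / ((L : ℝ) ^ k) ^ 4) ^ n * ∫ V, |Ψr (Q V)| ∂μ :=
        add_le_add (mul_le_mul_of_nonneg_right hq₁ hIs) (mul_le_mul_of_nonneg_right hq₂ hIr)

/-- **Route item `CondDecouplingGlue` (stmt-QuantumFields-26275)**:
`SmallFieldDecoupling → RoughFieldDecoupling → SmallEventMeasurable → CondDecoupling` (the previous theorem, read on the route
decl by `let`-expansion). -/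
theorem condDecouplingGlue_proof : CondDecouplingGlue := condDecoupling_of_split_expanded

end Summit.QuantumFields.YangMills.Cruxes.UVSeamRec.ExportGlue
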